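import Summits.CriticalPhenomena.CardyFormulaZ2.Theorems.CardySelfDualSegmentUniformBoxCrossingKernelIff
import Summits.CriticalPhenomena.CardyFormulaZ2.Theorems.CardySelfDualSegmentUniformMarginalityStubCrudeLeNonSlant
import Summits.CriticalPhenomena.CardyFormulaZ2.Theorems.CardySelfDualSegmentUniformMarginalityStubBoxBoundsLeCrude
import Summits.CriticalPhenomena.CardyFormulaZ2.Theorems.CardySelfDualSegmentUniformMarginalityThreeCruxes
import Summits.CriticalPhenomena.CardyFormulaZ2.Theorems.RectilinearCardy.Negative.RectilinearCardyReductions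
import HarnessLib

/-!
# Marginality at ONE tall rectangle + POINTWISE box crossing ⟹ `UniformBoxCrossing`
(crux `UniformMarginality`, stmt-CriticalPhenomena-5472, line `Sketch`; lead prover-line-stmt-CriticalPhenomena-5472-c11-0)

The t-UNIFORMITY MERGER of the route `CardySelfDualSegment` (Lines/Sketch.md §12: "the t-uniformity of the
two cruxes is one and the same"; recorded as provable-but-unlanded by leads c7 §14(a) and c8 (a′)), now a tree
theorem.  Let `Q₀ = (0,1) × (0,4)` (the model rectangle `rectQuad 0 1 0 4`, crossed from its bottom side
`arc 0` to its top side `arc 2`).  If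

* (marginality at `Q₀`) for every `t₀ ∈ [0,1]` and `ε > 0` there is `η > 0` with
  `|P_t(Q₀, δ) − P_{t₀}(Q₀, δ)| < ε` for all `t` with `dist t t₀ < η` and ALL meshes `δ > 0`
  (the crux `UniformMarginality`, or its rectilinear restriction UM_rect = split child 1, AT ONE RECTANGLE), and
* (pointwise box crossing) every single corner model `M_t = cornerPercolation t` has the box-crossing (RSW)
  property `HasBoxCrossingProperty (cornerPercolation t) squareLatticeEmbedding.z` (constants depending on `t`),

then the route crux `UniformBoxCrossing` (stmt-CriticalPhenomena-5476: box-crossing bounds with constants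
UNIFORM in `t`) holds.  Proof: by the landed engine of crux 5476 it suffices to prove the t-uniform non-slant
bound `NonSlantStatement` (`uniformBoxCrossing_of_nonSlant`, p-landed, `…UniformBoxCrossingEngine.lean`).
Fix `t₀`; pointwise box crossing at aspect ratio `9` and the inscribed-box sandwich `stub_inscribedTB` give
`c(t₀) ≤ P_{t₀}(Q₀, 1/m)` for all large `m` (`stub_boxBoundsLeCrude`, p156283); marginality at `Q₀`
transports this to `c(t₀)/2 ≤ P_t(Q₀, 1/m)` for `t` near `t₀`; and the forced-gate sandwich `stub_gateTB`, the
render lemmas of the 5476 engine (embedded ↔ lattice rectangles, transposition symmetry of `M_t`) and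
`tbCrossing_subset_nonSlantSet` bound `P_t(Q₀, 1/m)` by the `M_t`-probability of a non-slant vertical crossing
of the lattice square `[0,n]²` for `m ≈ 3n/8` (`stub_crudeLeNonSlant`, p155901).  Compactness of `[0,1]`
makes the constants uniform (`nonSlant_of_marginalityAt_of_pointwise`).

Consequences (all by composition with landed theorems):
* `uniformBoxCrossing_of_uniformMarginalityRect_of_pointwise` : UM_rect → (∀ t, box crossing for `M_t`) → UBC;
* `uniformBoxCrossing_of_uniformMarginality_of_pointwise` : the same from the crux `UniformMarginality` as filed;
* `uniformBoxCrossing_iff_pointwise_of_uniformMarginalityRect` : under UM_rect, UBC ⟺ pointwise box crossing;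
* `cardyFormulaZ2_of_rectilinearCruxes_pointwise` : SegmentOpen_rect → UM_rect → (∀ t, box crossing for `M_t`)
  → `CardyFormulaZ2` (from `cardyFormulaZ2_of_rectilinearCruxes`, p137925).
So, once the crux is restated over rectilinear conformal rectangles (certified split, glue p141446), the
planner may restate stmt-5476 POINTWISE: one Bollobás–Riordan-Conjecture-8.2 instance per `t`, no uniformity.
-/

noncomputable section

open Set Filter Metric MeasureTheory Complex
open scoped Topology
open Literature.Probability.RandomPlanarGeometry Literature.Probability.Percolation
open Literature.Probability.LatticeModels
open Summit.CriticalPhenomena.CardyFormulaZ2.Cruxes.UniformBoxCrossing.NonSlantLine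
open Summit.CriticalPhenomena.CardyFormulaZ2.Theorems.RectilinearCardy.Negative (isRectilinear_rectQuad)

namespace Summit.CriticalPhenomena.CardyFormulaZ2.Cruxes.UniformMarginality.HeatFlow

/-! ### The two sandwiches at the tall model rectangle `Q₀ = (0,1) × (0,4)` (landed stubs)

Upper sandwich `stub_crudeLeNonSlant` (p155901, `…StubCrudeLeNonSlant.lean`): for `8 m ≥ 3 n + 16` and
`5 m + 7 ≤ 4 n` the crude `M_t`-crossing probability of `Q₀` at mesh `1/m` is at most the `M_t`-probability of a
non-slant bottom-to-top open crossing of the lattice square `[0,n]²` (forced gate `stub_gateTB`, transposition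
symmetry, embedded-to-lattice render lemma, monotonicity in the side lengths, `tbCrossing_subset_nonSlantSet`).
Lower sandwich `stub_boxBoundsLeCrude` (p156283, `…StubBoxBoundsLeCrude.lean`): box-crossing bounds of the single
model `M_{t₀}` at aspect ratio `9` with constants `c, n₀` give `c ≤ P_{t₀}(Q₀, 1/m)` for `m ≥ max (2 n₀ + 2) 10`
(inscribed box `stub_inscribedTB`).
-/

/-! ### Local uniformity near one parameter, then compactness of `[0,1]` -/

/-- **Local step.** Marginality at `Q₀` around `t₀` and the box-crossing property of the single model
`M_{t₀}` give a non-slant lower bound uniform on a neighbourhood of `t₀`. -/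
theorem nonSlant_near (t₀ : unitInterval)
    (hUM₀ : ∀ ε : ℝ, 0 < ε → ∃ η > 0, ∀ t : unitInterval, dist t t₀ < η → ∀ δ : ℝ, 0 < δ →
      |cornerCrossingProb t (rectQuad 0 1 0 4 one_pos four_pos) δ -
        cornerCrossingProb t₀ (rectQuad 0 1 0 4 one_pos four_pos) δ| < ε)
    (hpt₀ : HasBoxCrossingProperty (cornerPercolation t₀) squareLatticeEmbedding.z) :
    ∃ c : ℝ, 0 < c ∧ ∃ η : ℝ, 0 < η ∧ ∃ n₁ : ℕ, ∀ t : unitInterval, dist t t₀ < η →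
      ∀ n : ℕ, n₁ ≤ n → c ≤ (cornerPercolation t).real {ω | ∃ x ∈ bottomSide n n, ∃ y ∈ topSide n n,
        5 * |y 0 - x 0| ≤ 3 * (n : ℤ) ∧ ω ∈ openConnIn (↑(rectangle n n)) x y} := by
  obtain ⟨c, hc, n₀, hB⟩ := hpt₀ 9 (by norm_num)
  obtain ⟨η, hη, hU⟩ := hUM₀ (c / 2) (half_pos hc)
  refine ⟨c / 2, half_pos hc, η, hη, 16 * n₀ + 40, fun t ht n hn => ?_⟩
  -- the mesh `1/m`, `m = ⌊(3n+16)/8⌋ + 1`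
  set m : ℕ := (3 * n + 16) / 8 + 1 with hm_def
  have h₁ : 3 * n + 16 ≤ 8 * m := by omega
  have h₂ : 5 * m + 7 ≤ 4 * n := by omega
  have hm₀ : 2 * n₀ + 2 ≤ m := by omega
  have hm10 : 10 ≤ m := by omega
  have hmpos : (0 : ℝ) < 1 / (m : ℝ) := by
    have : (0 : ℝ) < m := by exact_mod_cast (show 0 < m by omega)
    positivity
  have hlow := stub_boxBoundsLeCrude t₀ c n₀ m hB hm₀ hm10
  have hup := stub_crudeLeNonSlant t n m h₁ h₂
  have hnear := hU t ht (1 / (m : ℝ)) hmpos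
  rw [abs_lt] at hnear
  linarith [hnear.1]

/-- **Marginality at `Q₀` + pointwise box crossing ⟹ the t-uniform non-slant bound** (the kernel
statement `NonSlantStatement` of crux 5476's line), by compactness of `unitInterval`: finitely many of the
neighbourhoods of `nonSlant_near` cover `[0,1]`; take the least constant and the largest threshold. -/
theorem nonSlant_of_marginalityAt_of_pointwise
    (hUM : ∀ (t₀ : unitInterval) (ε : ℝ), 0 < ε → ∃ η > 0, ∀ t : unitInterval, dist t t₀ < η →
      ∀ δ : ℝ, 0 < δ → |cornerCrossingProb t (rectQuad 0 1 0 4 one_pos four_pos) δ -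
        cornerCrossingProb t₀ (rectQuad 0 1 0 4 one_pos four_pos) δ| < ε)
    (hpt : ∀ t : unitInterval, HasBoxCrossingProperty (cornerPercolation t) squareLatticeEmbedding.z) :
    NonSlantStatement := by
  choose c hc η hη n₁ hN using fun t₀ : unitInterval => nonSlant_near t₀ (hUM t₀) (hpt t₀)
  obtain ⟨T, hT⟩ := isCompact_univ.elim_finite_subcover (fun t₀ : unitInterval => Metric.ball t₀ (η t₀))
    (fun _ => Metric.isOpen_ball) (fun t _ => mem_iUnion.2 ⟨t, Metric.mem_ball_self (hη t)⟩)
  have hTne : T.Nonempty := by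
    obtain ⟨t₀, ht₀⟩ := mem_iUnion.1 (hT (mem_univ (0 : unitInterval)))
    obtain ⟨ht₀T, -⟩ := mem_iUnion.1 ht₀
    exact ⟨t₀, ht₀T⟩
  refine ⟨T.inf' hTne c, (Finset.lt_inf'_iff hTne).2 fun t₀ _ => hc t₀, T.sup n₁, fun t n hn => ?_⟩
  obtain ⟨t₀, ht₀⟩ := mem_iUnion.1 (hT (mem_univ t))
  obtain ⟨ht₀T, htball⟩ := mem_iUnion.1 ht₀
  have hn₁ : n₁ t₀ ≤ n := (Finset.le_sup ht₀T).trans hn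
  exact (Finset.inf'_le c ht₀T).trans (hN t₀ t (Metric.mem_ball.1 htball) n hn₁)

/-! ### The merger and its corollaries -/

open Summit.CriticalPhenomena.CardyFormulaZ2.Theses.CardySelfDualSegment

/-- **Marginality at the one tall rectangle `Q₀` + pointwise box crossing for every `M_t` ⟹ the route
crux `UniformBoxCrossing`** (engine `uniformBoxCrossing_of_nonSlant` of crux 5476's line). -/
theorem uniformBoxCrossing_of_marginalityAt_of_pointwise
    (hUM : ∀ (t₀ : unitInterval) (ε : ℝ), 0 < ε → ∃ η > 0, ∀ t : unitInterval, dist t t₀ < η →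
      ∀ δ : ℝ, 0 < δ → |cornerCrossingProb t (rectQuad 0 1 0 4 one_pos four_pos) δ -
        cornerCrossingProb t₀ (rectQuad 0 1 0 4 one_pos four_pos) δ| < ε)
    (hpt : ∀ t : unitInterval, HasBoxCrossingProperty (cornerPercolation t) squareLatticeEmbedding.z) :
    UniformBoxCrossing :=
  uniformBoxCrossing_of_nonSlant (nonSlant_of_marginalityAt_of_pointwise hUM hpt)

/-- **Registered form of the merger** (sub-goal `stub_uniformityMerger` of stmt-CriticalPhenomena-5472, line `Sketch`):
marginality at the one tall rectangle `Q₀ = (0,1) × (0,4)` and the box-crossing property of every single `M_t` imply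
the route crux `UniformBoxCrossing`. -/
theorem stub_uniformityMerger : (∀ (t₀ : unitInterval) (ε : ℝ), 0 < ε → ∃ η > 0, ∀ t : unitInterval, dist t t₀ < η → ∀ δ : ℝ, 0 < δ → |cornerCrossingProb t (rectQuad 0 1 0 4 one_pos four_pos) δ - cornerCrossingProb t₀ (rectQuad 0 1 0 4 one_pos four_pos) δ| < ε) → (∀ t : unitInterval, HasBoxCrossingProperty (cornerPercolation t) squareLatticeEmbedding.z) → UniformBoxCrossing :=
  uniformBoxCrossing_of_marginalityAt_of_pointwise

/-- **UM_rect + pointwise box crossing ⟹ `UniformBoxCrossing`.**  The hypothesis is quantitative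
marginality on RECTILINEAR conformal rectangles (split child `UniformMarginalityRect` = stub (B₁), in the
`cornerCrossingProb` form of `cardyFormulaZ2_of_rectilinearCruxes`); only its instance at `Q₀` is used
(`isRectilinear_rectQuad`). -/
theorem uniformBoxCrossing_of_uniformMarginalityRect_of_pointwise
    (hM : ∀ (t₀ : unitInterval) (R : ConformalRectangle),
      (∃ S : Finset (ℂ × ℂ), (∀ p ∈ S, p.1.re = p.2.re ∨ p.1.im = p.2.im) ∧
        frontier R.carrier ⊆ ⋃ p ∈ S, segment ℝ p.1 p.2) →
      ∀ ε : ℝ, 0 < ε → ∃ η > 0, ∀ t : unitInterval, dist t t₀ < η → ∀ δ : ℝ, 0 < δ →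
        |cornerCrossingProb t R δ - cornerCrossingProb t₀ R δ| < ε)
    (hpt : ∀ t : unitInterval, HasBoxCrossingProperty (cornerPercolation t) squareLatticeEmbedding.z) :
    UniformBoxCrossing :=
  uniformBoxCrossing_of_marginalityAt_of_pointwise
    (fun t₀ => hM t₀ _ (isRectilinear_rectQuad one_pos four_pos)) hpt

/-- **The crux `UniformMarginality` AS FILED + pointwise box crossing ⟹ `UniformBoxCrossing`** (the
route's `P t R δ` is `cornerCrossingProb t R δ` by `rfl`). -/
theorem uniformBoxCrossing_of_uniformMarginality_of_pointwise (hUM : UniformMarginality)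
    (hpt : ∀ t : unitInterval, HasBoxCrossingProperty (cornerPercolation t) squareLatticeEmbedding.z) :
    UniformBoxCrossing :=
  uniformBoxCrossing_of_marginalityAt_of_pointwise (fun t₀ => hUM t₀ _) hpt

/-- The converse direction is free: `UniformBoxCrossing` gives the box-crossing property of every single
`M_t` (the route's law `(prodBernoulli (prm t)).map cfg` is `cornerPercolation t` by `rfl`). -/
theorem hasBoxCrossingProperty_of_uniformBoxCrossing (h : UniformBoxCrossing) (t : unitInterval) :
    HasBoxCrossingProperty (cornerPercolation t) squareLatticeEmbedding.z := by
  intro ρ hρ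
  obtain ⟨c, hc, n₀, hb⟩ := h ρ hρ
  exact ⟨c, hc, n₀, hb t⟩

/-- **Under UM_rect, the crux `UniformBoxCrossing` is EQUIVALENT to pointwise box crossing**: the
t-uniformity of the route's two research cruxes is one and the same. -/
theorem uniformBoxCrossing_iff_pointwise_of_uniformMarginalityRect
    (hM : ∀ (t₀ : unitInterval) (R : ConformalRectangle),
      (∃ S : Finset (ℂ × ℂ), (∀ p ∈ S, p.1.re = p.2.re ∨ p.1.im = p.2.im) ∧
        frontier R.carrier ⊆ ⋃ p ∈ S, segment ℝ p.1 p.2) →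
      ∀ ε : ℝ, 0 < ε → ∃ η > 0, ∀ t : unitInterval, dist t t₀ < η → ∀ δ : ℝ, 0 < δ →
        |cornerCrossingProb t R δ - cornerCrossingProb t₀ R δ| < ε) :
    UniformBoxCrossing ↔
      ∀ t : unitInterval, HasBoxCrossingProperty (cornerPercolation t) squareLatticeEmbedding.z :=
  ⟨hasBoxCrossingProperty_of_uniformBoxCrossing,
    uniformBoxCrossing_of_uniformMarginalityRect_of_pointwise hM⟩

/-- **Cardy's formula on `ℤ²` from SegmentOpen_rect, UM_rect and POINTWISE box crossing of the corner
models** (`cardyFormulaZ2_of_rectilinearCruxes`, p137925, with its third hypothesis `UniformBoxCrossing`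
supplied by the merger). -/
theorem cardyFormulaZ2_of_rectilinearCruxes_pointwise
    (hO : (∀ (t₀ : unitInterval) (R : ConformalRectangle),
        (∃ S : Finset (ℂ × ℂ), (∀ p ∈ S, p.1.re = p.2.re ∨ p.1.im = p.2.im) ∧
          frontier R.carrier ⊆ ⋃ p ∈ S, segment ℝ p.1 p.2) →
        ∀ ε : ℝ, 0 < ε → ∃ η > 0, ∀ t : unitInterval, dist t t₀ < η → ∀ δ : ℝ, 0 < δ →
          |cornerCrossingProb t R δ - cornerCrossingProb t₀ R δ| < ε) →
      IsOpen {t : unitInterval | ∃ α : ℂ, 0 < α.im ∧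
        ∀ (R R' : ConformalRectangle)
          (φ : ConformalEquiv UpperHalfPlane.upperHalfPlaneSet R.carrier) (x : Fin 4 → ℝ),
          R.carrier = Literature.Barriers.CriticalPhenomena.moduliShear α '' R'.carrier →
          (∀ i, R.pt i = Literature.Barriers.CriticalPhenomena.moduliShear α (R'.pt i)) →
          R.IsUniformizing φ x →
          Tendsto (cornerCrossingProb t R') (𝓝[>] 0)
            (𝓝 (Literature.Probability.RandomPlanarGeometry.cardyFunction
              (Literature.Probability.RandomPlanarGeometry.crossRatio x)))})
    (hM : ∀ (t₀ : unitInterval) (R : ConformalRectangle),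
      (∃ S : Finset (ℂ × ℂ), (∀ p ∈ S, p.1.re = p.2.re ∨ p.1.im = p.2.im) ∧
        frontier R.carrier ⊆ ⋃ p ∈ S, segment ℝ p.1 p.2) →
      ∀ ε : ℝ, 0 < ε → ∃ η > 0, ∀ t : unitInterval, dist t t₀ < η → ∀ δ : ℝ, 0 < δ →
        |cornerCrossingProb t R δ - cornerCrossingProb t₀ R δ| < ε)
    (hpt : ∀ t : unitInterval, HasBoxCrossingProperty (cornerPercolation t) squareLatticeEmbedding.z) :
    _root_.CardyFormulaZ2 :=
  cardyFormulaZ2_of_rectilinearCruxes hO hM (uniformBoxCrossing_of_uniformMarginalityRect_of_pointwise hM hpt)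

end Summit.CriticalPhenomena.CardyFormulaZ2.Cruxes.UniformMarginality.HeatFlow

end
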